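import Summits.QuantumFields.YangMills.Theorems.ParabolicTrajectoryContinuumLimitOnTrajectoryReduction2
import Summits.QuantumFields.YangMills.Theorems.ParabolicTrajectoryContinuumLimitOnTrajectoryDefsF

/-!
# Route `ParabolicTrajectory`, crux `ContinuumLimitOnTrajectory` (stmt-QuantumFields-10522): the reduction of line `two-orbit-synchronisation`, v3.6 — the RESTATED crux (volume-growth clause) from three named statements

Helper file of the line lead (seat c4, `prover-line-stmt-QuantumFields-10522-c4-0`); sequel of `…Reduction` (v3.4, seat c3)
and `…Reduction2` (v3.5, seat c3). Skeleton v3.5 closes the crux BY NAME modulo four named statements: the PROMOTED chart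
`ChartExists`, the two physics inputs `IRPhysicsCS` / `UVPhysics345`, and `VolumeClause` — the crux's hypothesis block ⇒
`PolyVolumeGrowth sch`, which is NOT physics but the misstatement of (A) as typed (torus-seam report
`Cruxes/ContinuumLimitOnTrajectory/SEAM-two-orbit-synchronisation.md`). In `…Reduction2.reductionCS` the volume clause is
consumed at exactly one point (to produce `PolyVolumeGrowth sch` for the sequence at hand), so for the RESTATED crux
`ContinuumLimitOnTrajectoryPVG` of `…DefsF` ((A) verbatim + the clause `∃ N ≥ 1, ∀ᶠ k, (a_k)⁻¹ ≤ (a_k L_k)^N` in its block) the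
same wiring closes the statement from THREE named statements, none of them a misstatement:
* `Reduction.reductionPVG` — `TwoOrbitSync → ChartExists → Anatomy → IRPhysicsCS → UVPhysics345 → ARPOfRP → TranslOfUUVB →
  OneFieldOSLegs' → ContinuumLimitWithGapPVG` (the v3.5 wiring verbatim — adapted from `…Reduction2.reductionCS`, seat c3 —
  with `PolyVolumeGrowth sch` read from the restated block instead of from `VolumeClause`; conclusion strengthened by the
  continuum gap clause of the canonical witness, as in v3.5);
* `continuumLimitWithGapPVG_of_inputs`, `continuumLimitOnTrajectoryPVG_of_inputs` — **the restated crux from exactly three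
  named statements** `ChartExists` (PROMOTED), `IRPhysicsCS`, `UVPhysics345` (physics inputs), applied to the landed stubs
  `stub_sync`, `stub_anatomy`, `stub_arp`, `stub_transl`, `stub_osPackaging`;
* the crux AS TYPED, by name, is then `VolumeClause` + the restated statement
  (`…DefsF.continuumLimitOnTrajectory_of_volumeClause`): the v3.6 skeleton's composition, a re-bracketing of
  `…Reduction2.continuumLimitOnTrajectory_of_inputsCS` (same type, so not re-declared here).
Nothing here is an input or a named fact: the hypotheses are explicit antecedents. Refs: `…Reduction2`; `…DefsF`; SEAM note §4.
-/

set_option autoImplicit false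

open scoped SchwartzMap
open MeasureTheory Filter Topology
open Literature.MathematicalPhysics.QuantumFieldTheory Literature.MathematicalPhysics.QuantumLattice
open Literature.MathematicalPhysics.AQFT Literature.Probability.LatticeModels
open Summit.QuantumFields.YangMills.Theses.ParabolicTrajectory
open Summit.QuantumFields.YangMills.Theorems.ContinuumLegGivenGap
  (stub_uclOfCscl stub_asympCS stub_smallRotation stub_bddSlabDensity stub_rotOfPythagorean stub_rotNiven stub_rotHyper)

noncomputable section

namespace Summit.QuantumFields.YangMills.Cruxes.ContinuumLimitOnTrajectory.TwoOrbitSynchronisation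

namespace Reduction

/-- **The reduction for the restated crux, v3.6 (volume growth from the block; Cauchy–Schwarz currency, discrete rotation
restoration, gap of the witness).** The eight statements imply `ContinuumLimitWithGapPVG` (kernel-checked; wiring verbatim
as in `Reduction.reductionCS` — adapted from `…Reduction2`, seat c3 — except that `PolyVolumeGrowth sch` is the last
hypothesis of the restated block rather than the output of `VolumeClause`: `IRPhysicsCS` supplies `QualFiniteSize` and
`HasCSClustering r (canon r sch) Δ₁`; `UVPhysics345` supplies `UUVB`/`Rot345`/`ND2`/`ND3`, `AsympRot` follows by
`stub_rotOfPythagorean`, `UVB` by `uvb_of_uuvb`; `UCL` by `stub_uclOfCscl`; the slab reflection positivity by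
`torusSlabRP_of_tendsto`; and the gap clause of the witness by `IsYangMillsFor.hasMassGap_of_hasCSClustering`). -/
theorem reductionPVG :
    TwoOrbitSync → ChartExists → Anatomy → IRPhysicsCS → UVPhysics345 → ARPOfRP → TranslOfUUVB →
      OneFieldOSLegs' → ContinuumLimitWithGapPVG := by
  intro hsync hchart hanat hir huv harp htransl hlegs G _ _ _ _ hG
  letI : MeasurableSpace G := borel G
  haveI : BorelSpace G := ⟨rfl⟩
  intro r
  obtain ⟨M₀, hM₀⟩ := hchart G hG r
  refine ⟨M₀, fun M hM h2M => ?_⟩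
  obtain ⟨𝒞⟩ := hM₀ M hM h2M
  /- constants, independent of the tuning -/
  set κ₀ : ℝ := (1 - 𝒞.θ') / 2 with hκ₀_def
  have h1θ : 0 < 1 - 𝒞.θ' := by linarith [𝒞.θ'_lt_one]
  have hκ₀pos : 0 < κ₀ := by rw [hκ₀_def]; positivity
  have hdom : 𝒞.θ' * (1 + κ₀) < 1 := by
    rw [hκ₀_def]; nlinarith [𝒞.θ'_nonneg, 𝒞.θ'_lt_one, h1θ]
  obtain ⟨ε₀, K, θ₁, hε₀, hK, hθ₁0, hθ₁1, hS⟩ := hsync 𝒞.θ' κ₀ 𝒞.θ'_nonneg hκ₀pos.le hdom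
  -- the sub-window γ'
  have hev : ∀ᶠ x in 𝓝[>] (0 : ℝ), (0 < x ∧ x ≤ 𝒞.γ) ∧ 𝒞.Cκ * x ^ 2 ≤ κ₀ ∧
      𝒞.C₁ * (𝒞.C₃ * x ^ 3) ≤ ε₀ ∧ 8 * 𝒞.b * x ^ 2 ≤ 1 ∧ K * 𝒞.C₁ * (𝒞.ℓ₀ * x) ≤ 1 / 2 := by
    have hIoc : ∀ᶠ x in 𝓝[>] (0 : ℝ), 0 < x ∧ x ≤ 𝒞.γ := by
      filter_upwards [Ioo_mem_nhdsGT 𝒞.γ_pos] with x hx using ⟨hx.1, hx.2.le⟩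
    have hcts : ∀ (c : ℝ) {p : ℕ}, 0 < p → Tendsto (fun x : ℝ => c * x ^ p) (𝓝[>] 0) (𝓝 0) := by
      intro c p hp
      have hc : Continuous (fun x : ℝ => c * x ^ p) := by fun_prop
      have h := (hc.tendsto (0 : ℝ)).mono_left (nhdsWithin_le_nhds (s := Set.Ioi (0 : ℝ)))
      simpa [zero_pow hp.ne'] using h
    have h1 : ∀ᶠ x in 𝓝[>] (0 : ℝ), 𝒞.Cκ * x ^ 2 ≤ κ₀ := (hcts 𝒞.Cκ two_pos).eventually_le_const hκ₀pos
    have h2 : ∀ᶠ x in 𝓝[>] (0 : ℝ), 𝒞.C₁ * (𝒞.C₃ * x ^ 3) ≤ ε₀ :=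
      ((hcts (𝒞.C₁ * 𝒞.C₃) three_pos).eventually_le_const hε₀).mono fun x hx => by
        simpa only [mul_assoc] using hx
    have h3 : ∀ᶠ x in 𝓝[>] (0 : ℝ), 8 * 𝒞.b * x ^ 2 ≤ 1 :=
      (hcts (8 * 𝒞.b) two_pos).eventually_le_const one_pos
    have h4 : ∀ᶠ x in 𝓝[>] (0 : ℝ), K * 𝒞.C₁ * (𝒞.ℓ₀ * x) ≤ 1 / 2 :=
      ((hcts (K * 𝒞.C₁ * 𝒞.ℓ₀) one_pos).eventually_le_const (u := 1 / 2) (by norm_num)).mono fun x hx => by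
        simpa only [mul_assoc, pow_one] using hx
    exact hIoc.and (h1.and (h2.and (h3.and h4)))
  obtain ⟨γ', ⟨hγ'pos, hγ'le⟩, hκle, hprod, h8b, hsmall⟩ := hev.exists
  -- the synchronisation constants at (κ, c₁, c₃) = (Cκ γ'², C₁, C₃ γ'³)
  have hSk := hS (𝒞.Cκ * γ' ^ 2) 𝒞.C₁ (𝒞.C₃ * γ' ^ 3) (by have := 𝒞.Cκ_nonneg; positivity) hκle
    𝒞.C₁_nonneg (by have := 𝒞.C₃_nonneg; positivity) hprod
  /- the tuning data -/
  refine ⟨1, one_pos, fun θ Δ sch n hθ _ hΔ hshape hβ htower htune hgap hgrowth' => ?_⟩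
  have hgrowth : PolyVolumeGrowth sch := hgrowth'
  obtain ⟨hvol', Δ₁, hΔ₁, hCS⟩ := hir G hG r M θ Δ sch n hθ hΔ hshape hβ htower htune hgap hgrowth
  -- Wilson couplings (uses β_k → ∞)
  classical
  let g : ℕ → ℝ := fun k => if h : 𝒞.B₀ ≤ sch.β k then (𝒞.betaOf_surj (sch.β k) h).choose else 𝒞.g₀
  have hgk : ∀ᶠ k in atTop, g k ∈ Set.Ioc (0 : ℝ) 𝒞.g₀ ∧ 𝒞.betaOf (g k) = sch.β k := by
    filter_upwards [hβ.eventually_ge_atTop 𝒞.B₀] with k hk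
    simp only [g, dif_pos hk]
    exact (𝒞.betaOf_surj (sch.β k) hk).choose_spec
  have hgβ : Tendsto (fun k => 𝒞.betaOf (g k)) atTop atTop :=
    hβ.congr' (hgk.mono fun k hk => hk.2.symm)
  have hn : Tendsto n atTop atTop :=
    Summit.QuantumFields.YangMills.Theorems.LatticeGapOnTrajectory.Negative.tendsto_n_of_shape sch hshape
  -- infinite-volume towers (VolumeIndependence (b) + corr_tendsto)
  have hclose : ∀ t : ℕ, 0 < t → ∀ ε : ℝ, 0 < ε → ∀ᶠ k in atTop,
      |((M : ℝ) ^ n k) ^ 8 *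
          latticeConnectedCorr r.ρ (sch.β k) (sch.side k) r.curvature.F r.curvature.F (t * M ^ n k) -
        ((M : ℝ) ^ n k) ^ 8 * 𝒞.corrInf (g k) (t * M ^ n k)| ≤ ε := by
    intro t ht ε hε
    filter_upwards [hvol'.2 t ht ε hε, hgk] with k hk hg'
    have hT := 𝒞.corr_tendsto (g k) hg'.1 (t * M ^ n k)
    rw [hg'.2] at hT
    rw [← mul_sub, abs_mul, abs_of_nonneg (by positivity)]
    refine le_of_tendsto ((tendsto_const_nhds.sub hT).abs.const_mul _) (eventually_atTop.2 ⟨sch.L k, ?_⟩)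
    intro S hS'
    exact hk S hS'
  have htowerInf : ∀ t : ℕ, 0 < t → ∃ c : ℝ,
      Tendsto (fun k => ((M : ℝ) ^ n k) ^ 8 * 𝒞.corrInf (g k) (t * M ^ n k)) atTop (𝓝 c) := by
    intro t ht
    obtain ⟨c, hc⟩ := htower t ht
    exact ⟨c, tendsto_of_forall_eventually_abs_sub_le hc fun ε hε =>
      (hclose t ht ε hε).mono fun k hk => by rwa [abs_sub_comm] at hk⟩
  have htune1 : Tendsto (fun k => ((M : ℝ) ^ n k) ^ 8 * 𝒞.corrInf (g k) (M ^ n k)) atTop (𝓝 θ) := by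
    have h := hclose 1 one_pos
    simp only [one_mul] at h
    exact tendsto_of_forall_eventually_abs_sub_le htune fun ε hε =>
      (h ε hε).mono fun k hk => by rwa [abs_sub_comm] at hk
  /- anatomy (uses θ > 0) -/
  obtain ⟨m, g_low, J, hglow, hJ, hA⟩ :=
    hanat G r M 𝒞 γ' hγ'pos hγ'le h8b θ g n hθ (hgk.mono fun k hk => hk.1) hgβ hn htune1
  /- the pin and its readout sequence -/
  obtain ⟨t, ht, c_r, hc_r, η, hη, hpin⟩ := 𝒞.pin m g_low γ' hglow hγ'pos hγ'le
  obtain ⟨ct, hct⟩ := htowerInf t ht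
  have hRd : Tendsto (fun k => 𝒞.Rd m t (g k) (J k)) atTop (𝓝 ct) := by
    refine hct.congr' ?_
    filter_upwards [hA] with k hk
    rw [TwoOrbitChart.Rd, hk.1]
  /- the terminal chart points form a Cauchy sequence -/
  set q : ℕ → ℝ × 𝒞.E := fun k => 𝒞.orb (g k) (J k) with hq_def
  have hcauchy : CauchySeq q := by
    rw [cauchySeq_iff_tendsto_dist_atTop_0, ← prod_atTop_atTop_eq]
    have hmin : Tendsto (fun p : ℕ × ℕ => min (J p.1) (J p.2)) (atTop ×ˢ atTop) atTop :=
      tendsto_atTop.2 fun b => ((tendsto_atTop.1 (hJ.comp tendsto_fst) b).and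
        (tendsto_atTop.1 (hJ.comp tendsto_snd) b)).mono fun p hp => le_min hp.1 hp.2
    have hD : Tendsto (fun p : ℕ × ℕ => |𝒞.Rd m t (g p.1) (J p.1) - 𝒞.Rd m t (g p.2) (J p.2)|)
        (atTop ×ˢ atTop) (𝓝 0) := by
      have := ((hRd.comp tendsto_fst).sub (hRd.comp tendsto_snd)).abs
      simpa using this
    have hηp : Tendsto (fun p : ℕ × ℕ => |η (min (J p.1) (J p.2))|) (atTop ×ˢ atTop) (𝓝 0) := by
      simpa using (hη.comp hmin).abs
    have hP : Tendsto (fun p : ℕ × ℕ => θ₁ ^ (min (J p.1) (J p.2) - 𝒞.j₀)) (atTop ×ˢ atTop) (𝓝 0) :=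
      (tendsto_pow_atTop_nhds_zero_of_lt_one hθ₁0 hθ₁1).comp ((tendsto_sub_atTop_nat 𝒞.j₀).comp hmin)
    have hbound : Tendsto (fun p : ℕ × ℕ =>
        (1 + K * 𝒞.C₁) * ((2 / c_r) * (|𝒞.Rd m t (g p.1) (J p.1) - 𝒞.Rd m t (g p.2) (J p.2)| +
            |η (min (J p.1) (J p.2))|) + 4 * 𝒞.ℓ₀ * γ' * K * 𝒞.ρ * θ₁ ^ (min (J p.1) (J p.2) - 𝒞.j₀)) +
          2 * K * 𝒞.ρ * θ₁ ^ (min (J p.1) (J p.2) - 𝒞.j₀)) (atTop ×ˢ atTop) (𝓝 0) := by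
      have := ((((hD.add hηp).const_mul (2 / c_r)).add
        (hP.const_mul (4 * 𝒞.ℓ₀ * γ' * K * 𝒞.ρ))).const_mul (1 + K * 𝒞.C₁)).add
        (hP.const_mul (2 * K * 𝒞.ρ))
      simpa using this
    refine squeeze_zero' (Eventually.of_forall fun p => dist_nonneg) ?_ hbound
    filter_upwards [(hA.and hgk).prod_mk (hA.and hgk)] with p hp
    obtain ⟨⟨hA1, hg1⟩, ⟨hA2, hg2⟩⟩ := hp
    exact Reduction.pair_bound 𝒞 hγ'pos hγ'le hK hθ₁0 hc_r hsmall hSk hpin hg1.1 hg2.1 hA1.2.1 hA2.2.1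
      hA1.2.2.1 hA2.2.2.1 hA1.2.2.2.1 hA2.2.2.2.1 hA1.2.2.2.2 hA2.2.2.2.2
  /- the limit point, inside the closed window region -/
  obtain ⟨qs, hqs⟩ := cauchySeq_tendsto_of_complete hcauchy
  have hqW : ∀ᶠ k in atTop, q k ∈ 𝒞.W := by
    filter_upwards [hA] with k hk
    refine Set.mem_prod.2 ⟨⟨(hk.2.2.1 (J k) le_rfl).1, (hk.2.2.1 (J k) le_rfl).2.trans hγ'le⟩, ?_⟩
    rw [Metric.mem_closedBall, dist_zero_right]
    exact hk.2.2.2.1 (J k) hk.2.1 le_rfl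
  have hqsW : qs ∈ 𝒞.W := 𝒞.isClosed_W.mem_of_tendsto hqs hqW
  /- full-sequence convergence on products -/
  have hconv : ConvProducts r sch := by
    intro p hp f hf
    refine ⟨𝒞.expectInf qs p fun i => (blockDilate M)^[m] (f i), ?_⟩
    have hcont := (𝒞.continuousOn_expect p m f hf).continuousWithinAt hqsW
    have hv : Tendsto (fun k => 𝒞.expectInf (q k) p fun i => (blockDilate M)^[m] (f i)) atTop
        (𝓝 (𝒞.expectInf qs p fun i => (blockDilate M)^[m] (f i))) :=
      hcont.tendsto.comp (tendsto_nhdsWithin_iff.2 ⟨hqs, hqW⟩)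
    refine tendsto_of_forall_eventually_abs_sub_le hv fun ε hε => ?_
    filter_upwards [hvol'.1 p f hf ε hε, hA, hgk] with k hk hAk hg'
    have e1 : (𝒞.expectInf (q k) p fun i => (blockDilate M)^[m] (f i)) =
        𝒞.expectInf (𝒞.orb (g k) 0) p fun i => (blockDilate M)^[n k] (f i) := by
      show 𝒞.expectInf (𝒞.orb (g k) (J k)) p _ = _
      rw [𝒞.expect_iterate hg'.1 (J k) p]
      congr 1
      funext i
      rw [← Function.iterate_add_apply, hAk.1]
    have hlim := 𝒞.expect_wilson (g k) hg'.1 p fun i => (blockDilate M)^[n k] (f i)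
    rw [hg'.2] at hlim
    rw [e1]
    exact abs_sub_le_of_uniform hlim hk
  /- UV inputs, the three lattice-kinematics stubs, and the OS legs -/
  obtain ⟨hUUVB, h345, hND2, hND3⟩ :=
    huv G hG r M θ Δ sch n hθ hΔ hshape hβ htower htune hgap hgrowth hconv
  -- rotation restoration from ONE Pythagorean rotation (sibling crux stmt-15828, landed p133709 + p133202 + p133520)
  have hRot : AsympRot r sch := stub_rotOfPythagorean G r sch stub_rotNiven stub_rotHyper hUUVB h345
  have hUVB : UVB r sch := uvb_of_uuvb r sch hUUVB
  have hARP : ARP r sch := harp G r sch (torusSlabRP_of_tendsto r sch hβ) hUUVB hUVB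
  have hE1 : AsympEuclid r sch := (asympEuclid_iff r sch).2 ⟨htransl G r sch hgrowth hUUVB, hRot⟩
  -- E4 from Cauchy–Schwarz clustering of the canonical scheme (sibling crux stmt-15828, landed p132690 + wave-6 glue)
  have hUCL : UCL r sch :=
    stub_uclOfCscl G r sch stub_asympCS stub_smallRotation stub_bddSlabDensity hβ hUUVB hgrowth hRot ⟨Δ₁, hΔ₁, hCS⟩
  obtain ⟨T, hYM, hNT, hNG⟩ := hlegs G r sch hconv hUVB hE1 hARP hUCL hND2 hND3
  exact ⟨canon r sch, rfl, rfl, rfl, T, hYM, hNT, hNG, Δ₁, hΔ₁, hYM.hasMassGap_of_hasCSClustering hCS⟩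

end Reduction

/-- **`ContinuumLimitWithGapPVG` from three named statements** (the v3.6 reduction applied to the landed stubs `stub_sync`,
`stub_anatomy`, `stub_arp`, `stub_transl`, `stub_osPackaging`): the promoted chart, the IR physics input in Cauchy–Schwarz
currency and the UV physics input with discrete rotation restoration imply the restated crux together with the continuum gap
clause of the same witness. No volume stub. -/
theorem continuumLimitWithGapPVG_of_inputs :
    ChartExists → IRPhysicsCS → UVPhysics345 → ContinuumLimitWithGapPVG :=
  fun hchart hir huv =>
    Reduction.reductionPVG stub_sync hchart stub_anatomy hir huv stub_arp stub_transl stub_osPackaging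

/-- **The RESTATED crux `ContinuumLimitOnTrajectoryPVG` from three named statements** (`ChartExists` PROMOTED, `IRPhysicsCS`,
`UVPhysics345`): what closes stmt-QuantumFields-10522 once the planner restates (A) with the volume-growth clause — modulo the
chart and the two physics inputs only. -/
theorem continuumLimitOnTrajectoryPVG_of_inputs :
    ChartExists → IRPhysicsCS → UVPhysics345 → ContinuumLimitOnTrajectoryPVG :=
  fun hchart hir huv => continuumLimitOnTrajectoryPVG_of_withGapPVG (continuumLimitWithGapPVG_of_inputs hchart hir huv)

-- The crux AS TYPED, by name, factored through the restatement (skeleton v3.6 composition):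
--   `fun hchart hvol hir huv => continuumLimitOnTrajectory_of_volumeClause hvol
--      (continuumLimitOnTrajectoryPVG_of_inputs hchart hir huv) : ChartExists → VolumeClause → IRPhysicsCS →
--      UVPhysics345 → ContinuumLimitOnTrajectory`
-- has the type of the landed `…Reduction2.continuumLimitOnTrajectory_of_inputsCS` and is therefore not re-declared
-- here (dedup); the skeleton writes the λ-term directly.

end Summit.QuantumFields.YangMills.Cruxes.ContinuumLimitOnTrajectory.TwoOrbitSynchronisation

end
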